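import Literature.NumberTheory.LFunctions.FeketePolyaKernelCertificatesBlockWrappers
import HarnessLib

/-!
# No real zero for real primitive characters of conductor `18197 ≤ q ≤ 19026`: the Fekete–Pólya rows, in the kernel (rows deferred by the earlier engines)

Topic `Literature/NumberTheory/LFunctions`; namespace `Literature.NumberTheory.LFunctions`. THEOREMS only (no
definition, no named fact, no `sorry`; standard axioms): one PUBLIC theorem **`noRealZero{Odd,Even}_fp_<q>`** per
fundamental discriminant `D`, `|D| = q ∈ [18197, 19026]`, that admits a Fekete–Pólya witness but was DEFERRED by the per-position engines v1/v2 (walk too long for one `decide`) — for every primitive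
quadratic `χ` mod `q` of the parity of `D` and every `σ ∈ (0, 1)`, `L(σ, χ) ≠ 0` (statement shape of the
`interval_cases` bullets of the `NoRealZero{Odd,Even}…` range files, so a range assembly cites them by name).
Cell `parity-realchar`, kernel floor of the wide column (TARGET §2 row 19), Fekete–Pólya lane (seat prover-2).

Method (engine v4): `FeketePolyaKernelCertificatesBlock{,Wrappers}.lean` — the iterated partial sums of order
`K` of the induced character `χ↑(q·w)` are non-negative over one period, decided in the kernel BLOCKWISE on packed
base-`2^b` digits (`blockCert b B K (q·w) (tabs… b ps q w)`: sign tables of the character from the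
quadratic-residue bitsets of the prime factors of the conductor — the factor list is part of each certificate,
primality by `norm_num` — prefix sums by one big-integer multiplication per order and block, sign test by one
AND), hence `ℜL(σ, χ↑(q·w)) > 0` (Fekete–Pólya 1912 / MV §11.2.1 Exercise 7) and `L(σ, χ) ≠ 0` (positive Euler
factors, Exercise 8).  Witnesses `(w, K)` = the cheapest in the exact integer scan of this seat
(`HOME/parity-realchar-prover-2/fp-witnesses-*.tsv`; no kit); the digit width `b` is two bits above the size of
the running-sum bound recorded by the scan.  11 characters in this file (est. 73 kernel-s).
NOT covered here (no Fekete–Pólya witness with `w ≤ 40`, `q·w ≤ 4·10⁵`, `K ≤ 12`; the other Fekete–Pólya rows of this range are in the `NoRealZeroFeketePolyaX…` files) — left to the truncation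
certificates of the companion lane: see those files.

## References

* H. L. Montgomery, R. C. Vaughan, *Multiplicative Number Theory I*, CUP 2007, §9.3 Thm 9.13, §11.2.1
  Exercises 7–8. [MontgomeryVaughan2007]
* M. Fekete, G. Pólya, *Über ein Problem von Laguerre*, Rend. Circ. Mat. Palermo 34 (1912) 89–120. [FeketePolya1912]
-/

namespace Literature.NumberTheory.LFunctions

open FeketePolyaKernel

set_option maxHeartbeats 400000 in
/-- `D = 18197`: the even character `(·/18197)` of conductor `18197` (`18197`: 31 · 587) — Fekete–Pólya witness of order `5` along the induced modulus `18197·10 = 181970`, block certificate (digits of `73` bits, splitting depth `10`); est. `4.4` kernel-s. [cite: MontgomeryVaughan2007, §11.2.1 Exercises 7 (g), 8] -/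
theorem noRealZeroEven_fp_18197 :
    ∀ χ : DirichletCharacter ℂ 18197, χ.IsQuadratic → χ.IsPrimitive → χ.Even →
      ∀ σ : ℝ, 0 < σ → σ < 1 → χ.LFunction σ ≠ 0 :=
  good_even_of_odd_blk [31, 587] (by norm_num) (by decide) (by decide) 10 5 73 10 (by decide) (by decide) (by decide)
    (Or.inr (by decide +kernel))

set_option maxHeartbeats 400000 in
/-- `D = 18221`: the even character `(·/18221)` of conductor `18221` (`18221`: 7 · 19 · 137) — Fekete–Pólya witness of order `6` along the induced modulus `18221·6 = 109326`, block certificate (digits of `85` bits, splitting depth `9`); est. `3.2` kernel-s. [cite: MontgomeryVaughan2007, §11.2.1 Exercises 7 (g), 8] -/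
theorem noRealZeroEven_fp_18221 :
    ∀ χ : DirichletCharacter ℂ 18221, χ.IsQuadratic → χ.IsPrimitive → χ.Even →
      ∀ σ : ℝ, 0 < σ → σ < 1 → χ.LFunction σ ≠ 0 :=
  good_even_of_odd_blk [7, 19, 137] (by norm_num) (by decide) (by decide) 6 6 85 9 (by decide) (by decide) (by decide)
    (Or.inr (by decide +kernel))

set_option maxHeartbeats 400000 in
/-- `D = 18248`: the even character `χ₈·(·/2281)` of conductor `18248` (`2281`: prime) — Fekete–Pólya witness of order `4` along the induced modulus `18248·15 = 273720`, block certificate (digits of `59` bits, splitting depth `10`); est. `3.7` kernel-s. [cite: MontgomeryVaughan2007, §11.2.1 Exercises 7 (g), 8] -/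
theorem noRealZeroEven_fp_18248 :
    ∀ χ : DirichletCharacter ℂ 18248, χ.IsQuadratic → χ.IsPrimitive → χ.Even →
      ∀ σ : ℝ, 0 < σ → σ < 1 → χ.LFunction σ ≠ 0 :=
  good_even_of_eight_blk [2281] (by norm_num) (by decide) (by decide) 15 4 59 10 (by decide) (by decide) (by decide)
    (Or.inl (by decide +kernel)) (Or.inr (by decide +kernel))

set_option maxHeartbeats 400000 in
/-- `D = -18292`: the odd character `χ₋₄·(·/4573)` of conductor `18292` (`4573`: 17 · 269) — Fekete–Pólya witness of order `7` along the induced modulus `18292·15 = 274380`, block certificate (digits of `108` bits, splitting depth `11`); est. `10.0` kernel-s. [cite: MontgomeryVaughan2007, §11.2.1 Exercises 7 (g), 8] -/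
theorem noRealZeroOdd_fp_18292 :
    ∀ χ : DirichletCharacter ℂ 18292, χ.IsQuadratic → χ.IsPrimitive → χ.Odd →
      ∀ σ : ℝ, 0 < σ → σ < 1 → χ.LFunction σ ≠ 0 :=
  good_odd_of_four_blk [17, 269] (by norm_num) (by decide) (by decide) 15 7 108 11 (by decide) (by decide) (by decide)
    (Or.inr (by decide +kernel))

set_option maxHeartbeats 400000 in
/-- `D = -18379`: the odd character `(·/18379)` of conductor `18379` (`18379`: prime) — Fekete–Pólya witness of order `5` along the induced modulus `18379·14 = 257306`, block certificate (digits of `76` bits, splitting depth `10`); est. `7.2` kernel-s. [cite: MontgomeryVaughan2007, §11.2.1 Exercises 7 (g), 8] -/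
theorem noRealZeroOdd_fp_18379 :
    ∀ χ : DirichletCharacter ℂ 18379, χ.IsQuadratic → χ.IsPrimitive → χ.Odd →
      ∀ σ : ℝ, 0 < σ → σ < 1 → χ.LFunction σ ≠ 0 :=
  good_odd_of_odd_blk [18379] (by norm_num) (by decide) (by decide) 14 5 76 10 (by decide) (by decide) (by decide)
    (Or.inr (by decide +kernel))

set_option maxHeartbeats 400000 in
/-- `D = 18380`: the even character `χ₋₄·(·/4595)` of conductor `18380` (`4595`: 5 · 919) — Fekete–Pólya witness of order `3` along the induced modulus `18380·21 = 385980`, block certificate (digits of `43` bits, splitting depth `10`); est. `3.6` kernel-s. [cite: MontgomeryVaughan2007, §11.2.1 Exercises 7 (g), 8] -/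
theorem noRealZeroEven_fp_18380 :
    ∀ χ : DirichletCharacter ℂ 18380, χ.IsQuadratic → χ.IsPrimitive → χ.Even →
      ∀ σ : ℝ, 0 < σ → σ < 1 → χ.LFunction σ ≠ 0 :=
  good_even_of_four_blk [5, 919] (by norm_num) (by decide) (by decide) 21 3 43 10 (by decide) (by decide) (by decide)
    (Or.inr (by decide +kernel))

set_option maxHeartbeats 400000 in
/-- `D = 18440`: the even character `χ₈·(·/2305)` of conductor `18440` (`2305`: 5 · 461) — Fekete–Pólya witness of order `8` along the induced modulus `18440·17 = 313480`, block certificate (digits of `122` bits, splitting depth `11`); est. `14.0` kernel-s. [cite: MontgomeryVaughan2007, §11.2.1 Exercises 7 (g), 8] -/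
theorem noRealZeroEven_fp_18440 :
    ∀ χ : DirichletCharacter ℂ 18440, χ.IsQuadratic → χ.IsPrimitive → χ.Even →
      ∀ σ : ℝ, 0 < σ → σ < 1 → χ.LFunction σ ≠ 0 :=
  good_even_of_eight_blk [5, 461] (by norm_num) (by decide) (by decide) 17 8 122 11 (by decide) (by decide) (by decide)
    (Or.inl (by decide +kernel)) (Or.inr (by decide +kernel))

set_option maxHeartbeats 400000 in
/-- `D = -18532`: the odd character `χ₋₄·(·/4633)` of conductor `18532` (`4633`: 41 · 113) — Fekete–Pólya witness of order `3` along the induced modulus `18532·15 = 277980`, block certificate (digits of `45` bits, splitting depth `10`); est. `2.7` kernel-s. [cite: MontgomeryVaughan2007, §11.2.1 Exercises 7 (g), 8] -/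
theorem noRealZeroOdd_fp_18532 :
    ∀ χ : DirichletCharacter ℂ 18532, χ.IsQuadratic → χ.IsPrimitive → χ.Odd →
      ∀ σ : ℝ, 0 < σ → σ < 1 → χ.LFunction σ ≠ 0 :=
  good_odd_of_four_blk [41, 113] (by norm_num) (by decide) (by decide) 15 3 45 10 (by decide) (by decide) (by decide)
    (Or.inr (by decide +kernel))

set_option maxHeartbeats 400000 in
/-- `D = 18572`: the even character `χ₋₄·(·/4643)` of conductor `18572` (`4643`: prime) — Fekete–Pólya witness of order `6` along the induced modulus `18572·15 = 278580`, block certificate (digits of `91` bits, splitting depth `11`); est. `8.4` kernel-s. [cite: MontgomeryVaughan2007, §11.2.1 Exercises 7 (g), 8] -/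
theorem noRealZeroEven_fp_18572 :
    ∀ χ : DirichletCharacter ℂ 18572, χ.IsQuadratic → χ.IsPrimitive → χ.Even →
      ∀ σ : ℝ, 0 < σ → σ < 1 → χ.LFunction σ ≠ 0 :=
  good_even_of_four_blk [4643] (by norm_num) (by decide) (by decide) 15 6 91 11 (by decide) (by decide) (by decide)
    (Or.inr (by decide +kernel))

set_option maxHeartbeats 400000 in
/-- `D = -18827`: the odd character `(·/18827)` of conductor `18827` (`18827`: 67 · 281) — Fekete–Pólya witness of order `6` along the induced modulus `18827·14 = 263578`, block certificate (digits of `92` bits, splitting depth `11`); est. `7.8` kernel-s. [cite: MontgomeryVaughan2007, §11.2.1 Exercises 7 (g), 8] -/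
theorem noRealZeroOdd_fp_18827 :
    ∀ χ : DirichletCharacter ℂ 18827, χ.IsQuadratic → χ.IsPrimitive → χ.Odd →
      ∀ σ : ℝ, 0 < σ → σ < 1 → χ.LFunction σ ≠ 0 :=
  good_odd_of_odd_blk [67, 281] (by norm_num) (by decide) (by decide) 14 6 92 11 (by decide) (by decide) (by decide)
    (Or.inr (by decide +kernel))

set_option maxHeartbeats 400000 in
/-- `D = 18989`: the even character `(·/18989)` of conductor `18989` (`18989`: 17 · 1117) — Fekete–Pólya witness of order `6` along the induced modulus `18989·14 = 265846`, block certificate (digits of `91` bits, splitting depth `11`); est. `7.9` kernel-s. [cite: MontgomeryVaughan2007, §11.2.1 Exercises 7 (g), 8] -/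
theorem noRealZeroEven_fp_18989 :
    ∀ χ : DirichletCharacter ℂ 18989, χ.IsQuadratic → χ.IsPrimitive → χ.Even →
      ∀ σ : ℝ, 0 < σ → σ < 1 → χ.LFunction σ ≠ 0 :=
  good_even_of_odd_blk [17, 1117] (by norm_num) (by decide) (by decide) 14 6 91 11 (by decide) (by decide) (by decide)
    (Or.inr (by decide +kernel))

end Literature.NumberTheory.LFunctions
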